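import Mathlib
import HarnessLib

/-!
# `NoHeavyLowerTail` (crux stmt-CriticalPhenomena-4575), Sahi programme P5: a kernel-checkable positivity certificate for
# SPARSE polynomials on the unit cube — tensor-Bernstein coefficients at an arbitrary multidegree

Support file (seat `prim-l12-p5`, gen 6; `--supports stmt-CriticalPhenomena-4575`).  Everything proved; no named facts; no sorries;
standard axioms.  Companion of `…NCopyCertAlgebra` / `…SahiRecursionCert` (gen 5: the Lieb–Sahi recursion on Kronecker numbers at
the UNIFORM multidegree `(n,…,n)` of the `n`-copy expansion).  Here the input is an explicit sparse polynomial
`P(x) = Σ_r c_r ∏_i x_i^{e_{r,i}}` (`R` integer terms in `k` variables) and a multidegree `d` with `e_r ≤ d`, and the certificate is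
the classical one [folklore; Bernstein 1912 / Cargo–Shisha 1966 for the univariate bound]:

  `P(x) = Σ_{j ≤ d} N_j · ∏_i x_i^{j_i}(1 − x_i)^{d_i − j_i}`,  `N_j = Σ_r c_r ∏_i [e_{r,i} ≤ j_i]·C(d_i − e_{r,i}, j_i − e_{r,i})`

(`evalT_eq_sum_bcoef`; expand `x^e = x^e (x + (1−x))^{d−e}` coordinatewise), so `N_j ≥ 0` for all `j ≤ d` gives `P ≥ 0` on `[0,1]^k`
(`evalT_nonneg_of_bcoef`).  The point of the file is the CHECKER `check T d` (`go`): it enumerates the box `∏_i {0..d_i}` depth-first with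
the `R` running products `c_r ∏_{i' < i} (column factor)` carried along (cost `≈ R · Σ_i ∏_{i' ≤ i} (d_{i'}+1)` small-integer
multiplications, no big numbers), and `check_sound : check T d = true → ∀ j ≤ d, 0 ≤ N_j`.  Used by `…SahiE4HittingEvents`
(`k = 15`, `R = 47`, box of `14 929 920` profiles: Kahn's `E₄ ≥ 0` for four hitting events) and re-checked on the seven-variable
`E₃` polynomial of `…SahiE3HittingEvents`.
-/

namespace Summit.CriticalPhenomena.PercolationContinuityZ3.Theorems

namespace SparseBernstein

open Finset

/-! ## The column factor and the three objects: evaluation, Bernstein basis, Bernstein coefficient -/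

/-- The column factor `[e ≤ j]·C(d − e, j − e)` of the coefficient of `x^j(1−x)^{d−j}` in `x^e·(x + (1 − x))^{d−e}`. [folklore] -/
def vfac (d e j : ℕ) : ℤ := if e ≤ j then ((d - e).choose (j - e) : ℤ) else 0

variable {k R : ℕ}

/-- Evaluation of the sparse polynomial with term table `T` (coefficient, exponent vector) at `x`. [folklore] -/
noncomputable def evalT (T : Fin R → ℤ × (Fin k → ℕ)) (x : Fin k → ℝ) : ℝ :=
  ∑ r, ((T r).1 : ℝ) * ∏ i, x i ^ (T r).2 i

/-- The tensor-Bernstein basis function of multidegree `d` at profile `j`. [folklore] -/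
noncomputable def bern (d j : Fin k → ℕ) (x : Fin k → ℝ) : ℝ := ∏ i, (x i ^ j i * (1 - x i) ^ (d i - j i))

/-- The tensor-Bernstein coefficient of the sparse polynomial `T` at multidegree `d`, profile `j`. [folklore] -/
def bcoef (T : Fin R → ℤ × (Fin k → ℕ)) (d j : Fin k → ℕ) : ℤ :=
  ∑ r, (T r).1 * ∏ i, vfac (d i) ((T r).2 i) (j i)

/-- The box of profiles `j ≤ d`. [folklore] -/
def box (d : Fin k → ℕ) : Finset (Fin k → ℕ) := Fintype.piFinset fun i => Finset.range (d i + 1)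

/-! ## The expansion -/

/-- One variable: `x^e = Σ_{j ≤ d} [e ≤ j] C(d−e, j−e) · x^j (1−x)^{d−j}` for `e ≤ d`. [folklore] -/
theorem pow_eq_sum_vfac (x : ℝ) {d e : ℕ} (he : e ≤ d) :
    x ^ e = ∑ j ∈ Finset.range (d + 1), (vfac d e j : ℝ) * (x ^ j * (1 - x) ^ (d - j)) := by
  have hbin : (x + (1 - x)) ^ (d - e) =
      ∑ m ∈ Finset.range (d - e + 1), x ^ m * (1 - x) ^ (d - e - m) * ((d - e).choose m : ℝ) := add_pow x (1 - x) (d - e)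
  have h1 : x ^ e = x ^ e * (x + (1 - x)) ^ (d - e) := by
    rw [show x + (1 - x) = 1 by ring, one_pow, mul_one]
  rw [h1, hbin, Finset.mul_sum]
  -- reindex `j = e + m`
  have hsplit : ∑ j ∈ Finset.range (d + 1), (vfac d e j : ℝ) * (x ^ j * (1 - x) ^ (d - j))
      = ∑ j ∈ Finset.Ico e (d + 1), (vfac d e j : ℝ) * (x ^ j * (1 - x) ^ (d - j)) := by
    rw [Finset.range_eq_Ico]
    symm
    refine Finset.sum_subset (Finset.Ico_subset_Ico_left (Nat.zero_le e)) fun j hj hj' => ?_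
    have hlt : j < e := by
      simp only [Finset.mem_Ico, Nat.zero_le, true_and, not_and, not_lt] at hj hj'
      by_contra h
      exact absurd (hj' (not_lt.1 h)) (not_le.2 hj)
    simp [vfac, not_le.2 hlt]
  rw [hsplit, Finset.sum_Ico_eq_sum_range]
  have hde : d + 1 - e = d - e + 1 := by omega
  rw [hde]
  refine Finset.sum_congr rfl fun m hm => ?_
  have hm' : m ≤ d - e := by simpa [Finset.mem_range, Nat.lt_succ_iff] using hm
  have hv : vfac d e (e + m) = ((d - e).choose m : ℤ) := by
    simp [vfac]
  rw [hv, pow_add]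
  have hexp : d - (e + m) = d - e - m := by omega
  rw [hexp]
  push_cast
  ring

/-- Every monomial of multidegree `≤ d` is a combination of the degree-`d` tensor-Bernstein basis with the product column factors.
[folklore] -/
theorem prod_pow_eq_sum_bern (x : Fin k → ℝ) {d e : Fin k → ℕ} (he : ∀ i, e i ≤ d i) :
    ∏ i, x i ^ e i = ∑ j ∈ box d, (∏ i, (vfac (d i) (e i) (j i) : ℝ)) * bern d j x := by
  have h1 : ∏ i, x i ^ e i
      = ∏ i, ∑ j ∈ Finset.range (d i + 1), (vfac (d i) (e i) j : ℝ) * (x i ^ j * (1 - x i) ^ (d i - j)) :=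
    Finset.prod_congr rfl fun i _ => pow_eq_sum_vfac (x i) (he i)
  rw [h1, Finset.prod_univ_sum]
  refine Finset.sum_congr rfl fun j _ => ?_
  rw [bern, ← Finset.prod_mul_distrib]

/-- **The tensor-Bernstein expansion of a sparse polynomial**: `P(x) = Σ_{j ≤ d} N_j · b^d_j(x)`. [folklore] -/
theorem evalT_eq_sum_bcoef (T : Fin R → ℤ × (Fin k → ℕ)) (d : Fin k → ℕ) (hdeg : ∀ r i, (T r).2 i ≤ d i)
    (x : Fin k → ℝ) : evalT T x = ∑ j ∈ box d, (bcoef T d j : ℝ) * bern d j x := by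
  unfold evalT
  have h1 : ∑ r, ((T r).1 : ℝ) * ∏ i, x i ^ (T r).2 i
      = ∑ r, ∑ j ∈ box d, ((T r).1 : ℝ) * ((∏ i, (vfac (d i) ((T r).2 i) (j i) : ℝ)) * bern d j x) := by
    refine Finset.sum_congr rfl fun r _ => ?_
    rw [prod_pow_eq_sum_bern x (hdeg r), Finset.mul_sum]
  rw [h1, Finset.sum_comm]
  refine Finset.sum_congr rfl fun j _ => ?_
  rw [bcoef]
  push_cast
  rw [Finset.sum_mul]
  refine Finset.sum_congr rfl fun r _ => ?_
  ring

/-- The Bernstein basis is nonnegative on the unit cube. [folklore] -/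
theorem bern_nonneg (d j : Fin k → ℕ) {x : Fin k → ℝ} (hx : ∀ i, 0 ≤ x i ∧ x i ≤ 1) : 0 ≤ bern d j x :=
  Finset.prod_nonneg fun i _ => mul_nonneg (pow_nonneg (hx i).1 _) (pow_nonneg (sub_nonneg.2 (hx i).2) _)

/-- **Positivity from nonnegative Bernstein coefficients**: if every `N_j ≥ 0` (`j ≤ d`) then `P ≥ 0` on `[0,1]^k`. [folklore] -/
theorem evalT_nonneg_of_bcoef (T : Fin R → ℤ × (Fin k → ℕ)) (d : Fin k → ℕ) (hdeg : ∀ r i, (T r).2 i ≤ d i)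
    (hN : ∀ j ∈ box d, 0 ≤ bcoef T d j) {x : Fin k → ℝ} (hx : ∀ i, 0 ≤ x i ∧ x i ≤ 1) : 0 ≤ evalT T x := by
  rw [evalT_eq_sum_bcoef T d hdeg x]
  exact Finset.sum_nonneg fun j hj => mul_nonneg (by exact_mod_cast hN j hj) (bern_nonneg d j hx)

/-! ## The depth-first checker -/

/-- Depth-first enumeration of the box with running products: `cols` lists, for each remaining coordinate, the admissible
columns (one per digit `j_i ≤ d_i`), each column being the vector over terms of its factors; `P` is the vector of running
products.  At a leaf the sum must be `≥ 0`. [this work] -/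
def go : List (List (List ℤ)) → List ℤ → Bool
  | [], P => decide (0 ≤ P.sum)
  | col :: rest, P => col.all fun v => go rest (List.zipWith (· * ·) P v)

/-- Soundness of the enumeration: every admissible path of column choices ends in a nonnegative sum. [this work] -/
theorem go_sound : ∀ (cols : List (List (List ℤ))) (P : List ℤ), go cols P = true →
    ∀ vs : List (List ℤ), List.Forall₂ (· ∈ ·) vs cols →
      0 ≤ (vs.foldl (fun acc v => List.zipWith (· * ·) acc v) P).sum
  | [], P, h, vs, hvs => by
    cases hvs
    simpa [go] using h
  | col :: rest, P, h, vs, hvs => by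
    cases hvs with
    | cons hav hrest =>
      rename_i a s
      simp only [go, List.all_eq_true] at h
      exact go_sound rest _ (h a hav) s hrest

/-- The column table of the term table `T` at multidegree `d` (coordinates in order, digits `0..d_i`, terms in order). [this work] -/
def tab (T : Fin R → ℤ × (Fin k → ℕ)) (d : Fin k → ℕ) : List (List (List ℤ)) :=
  (List.finRange k).map fun i => (List.range (d i + 1)).map fun j => (List.finRange R).map fun r => vfac (d i) ((T r).2 i) j

/-- **The checker**: all tensor-Bernstein coefficients of `T` at multidegree `d` are `≥ 0`. [this work] -/
def check (T : Fin R → ℤ × (Fin k → ℕ)) (d : Fin k → ℕ) : Bool :=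
  go (tab T d) ((List.finRange R).map fun r => (T r).1)

/-- Pointwise product of two maps over the same list. [folklore] -/
theorem zipWith_mul_map {α : Type*} (l : List α) (g h : α → ℤ) :
    List.zipWith (· * ·) (l.map g) (l.map h) = l.map fun a => g a * h a := by
  induction l with
  | nil => rfl
  | cons a t ih => simp [ih]

/-- The running products along the path of a profile `j`. [this work] -/
theorem foldl_path (T : Fin R → ℤ × (Fin k → ℕ)) (d j : Fin k → ℕ) :
    ∀ (is : List (Fin k)) (g : Fin R → ℤ),
      (is.map fun i => (List.finRange R).map fun r => vfac (d i) ((T r).2 i) (j i)).foldl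
          (fun acc v => List.zipWith (· * ·) acc v) ((List.finRange R).map g)
        = (List.finRange R).map fun r => g r * (is.map fun i => vfac (d i) ((T r).2 i) (j i)).prod
  | [], g => by simp
  | i :: is, g => by
    rw [List.map_cons, List.foldl_cons, zipWith_mul_map, foldl_path T d j is]
    simp [mul_assoc]

/-- **Soundness of the checker**: `check T d = true` implies `N_j ≥ 0` for every profile `j ≤ d`. [this work] -/
theorem check_sound (T : Fin R → ℤ × (Fin k → ℕ)) (d : Fin k → ℕ) (h : check T d = true) :
    ∀ j ∈ box d, 0 ≤ bcoef T d j := by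
  intro j hj
  have hjd : ∀ i, j i ≤ d i := fun i => by
    have := Fintype.mem_piFinset.1 hj i
    simpa [Finset.mem_range, Nat.lt_succ_iff] using this
  -- the path of `j`
  set vs : List (List ℤ) :=
    (List.finRange k).map fun i => (List.finRange R).map fun r => vfac (d i) ((T r).2 i) (j i) with hvs
  have hmem : List.Forall₂ (· ∈ ·) vs (tab T d) := by
    rw [hvs, tab, List.forall₂_map_left_iff, List.forall₂_map_right_iff, List.forall₂_same]
    intro i _
    exact List.mem_map.2 ⟨j i, by simpa [Finset.mem_range, Nat.lt_succ_iff] using hjd i, rfl⟩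
  have h0 := go_sound _ _ h vs hmem
  rw [hvs, foldl_path T d j (List.finRange k) (fun r => (T r).1)] at h0
  -- identify the leaf sum with `bcoef`
  have hsum : ((List.finRange R).map fun r =>
      (T r).1 * ((List.finRange k).map fun i => vfac (d i) ((T r).2 i) (j i)).prod).sum = bcoef T d j := by
    rw [bcoef, Fin.sum_univ_def]
    refine congrArg List.sum (List.map_congr_left fun r _ => ?_)
    rw [Fin.prod_univ_def]
  rw [hsum] at h0
  exact h0

end SparseBernstein

end Summit.CriticalPhenomena.PercolationContinuityZ3.Theorems
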